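import Mathlib
import Literature.Analysis.FluidPDE.VectorCalculus
import Literature.Geometry.DiscreteGeometry.LayerShells
import Summits.NavierStokesRegularity.NavierStokesRegularity.Theorems.ThreadingFluxErtelTowerLinearFlowTower
import Summits.NavierStokesRegularity.NavierStokesRegularity.Theorems.ThreadingFluxErtelTowerStrainShadowFrameFree
import HarnessLib

/-!
# Crux `PoloidalLiouville` (stmt-NavierStokesRegularity-1222, W1), crux idea «radial-jerk-tower» (ns-idea-15 g7):
# INVISCID LINEAR-FLOW RIGIDITY, II — `InviscidStrainRigidity` SURVIVES BACKGROUND VORTICITY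

Support file (`--supports stmt-NavierStokesRegularity-1222`, helper).  Experiment cell `ns-wall-extremal`, width hand
ns-wall-eng-5 g8, item (ε) «INVISCID LINEAR-FLOW RIGIDITY WITH SPIN» (critic of record ns-wall-crit-1 g6, batch #9: paper check
re-derived, NO STRIKE, sizes E1 M / E2 M).  0 kit.

File I (`…LinearFlowTower`, E1) reduced the inviscid shadow of the wall in a GENERAL linear drift `u = A(x − x₀)` to the cubic
discriminant `D_A(z) = ⟪z, (A + A†)z × (A†(A + A†) + (A + A†)A)z⟫`: if `D_A ≢ 0`, every smooth field frozen into `u` and tangent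
to the spheres about `x₀` vanishes (`linearFlowRigidity_of_ne_zero`, over `inviscidKinematicRigidity` by name).  Here:

* `linDisc_symm_apply` — in an orthonormal eigenframe `u` of the symmetrised gradient `A + A†` (eigenvalues `e`, the doubled
  principal strain rates) the discriminant is, up to the orientation sign `ε = ±1` of the frame, the EXPLICIT cubic
  `P(y) = ⟪y, diag(e)y × C y⟫`, `C_ij = (eᵢ − eⱼ)·⟪uᵢ, A uⱼ⟫ (i ≠ j)`, `C_ii = eᵢ²` — the spin `⟪uᵢ, A uⱼ⟫ = −⟪uⱼ, A uᵢ⟫` enters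
  only through the off-diagonal entries;
* ★ `linDisc_exists_ne_zero_of_triaxial` — if the three rates are pairwise distinct then `D_A ≢ 0` WHATEVER THE SPIN: the signed
  sum of `P` over the eight frame corners `(±1,±1,±1)` is `8(e₀−e₁)(e₁−e₂)(e₂−e₀) ≠ 0` (it isolates the `y₀y₁y₂`-coefficient, to
  which the spin does not contribute);
* ★★ `inviscidLinearFlowRigidity_triaxial` — **INVISCID STRAIN RIGIDITY SURVIVES BACKGROUND VORTICITY**: at a stagnation point whose
  velocity gradient `A` has a TRIAXIAL symmetric part (orthonormal eigenframe of `A + A†` with pairwise distinct eigenvalues —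
  CentreJet L1 vocabulary), for ANY antisymmetric part (background vorticity) and any trace, no non-zero smooth field frozen into
  `u = A(x − x₀)` on an open space-time set stays tangent to the spheres about `x₀`.  `InviscidStrainRigidity` (p694495) is the
  case `A = A†` diagonal, `x₀ = 0`.

With E1's witness (`linearFlow_frozen_witness`: `e × (x − x₀)` is frozen whenever `A` commutes with `z ↦ e × z`) this leaves exactly
the two-rate strains with tilted spin for the full dichotomy «frozen sphere-tangent fields exist ⟺ the linear flow is axisymmetric»
(E3, critic's formula `D = −(a−c)²z₃²(ω₁z₁ + ω₂z₂)`).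

HONEST FRAME: statements about the INVISCID LINEAR shadow (prescribed linear drift); helper/information-grade; W1 movement 0;
`PoloidalLiouville` (1222) / (27585) OPEN; NS regularity NOT proved.
-/

-- the summit and its single problem share the name (D-0017 nested layout)
set_option linter.dupNamespace false

noncomputable section

namespace Summit.NavierStokesRegularity.NavierStokesRegularity.Theorems.PoloidalLiouville.ErtelTower

open Set Function
open scoped Topology RealInnerProductSpace InnerProductSpace
open Literature.Analysis.FluidPDE
open Literature.Geometry.DiscreteGeometry (inner_fin3)
open Summit.NavierStokesRegularity.NavierStokesRegularity.Theorems.PoloidalLiouville.HorizonTower (E3 cross_fin3)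
open Summit.NavierStokesRegularity.NavierStokesRegularity.Theorems.PoloidalLiouville.CentreJet.TriaxialFrame
  (exists_orthonormalBasis_eq)

section Frame

variable {A : E3 →L[ℝ] E3} {u : Fin 3 → E3} {e : Fin 3 → ℝ} {ob : OrthonormalBasis (Fin 3) ℝ E3}

/-- The symmetrised gradient `A + A†` is self-adjoint. -/
theorem adjoint_symmPart (A : E3 →L[ℝ] E3) :
    ContinuousLinearMap.adjoint (A + ContinuousLinearMap.adjoint A) = A + ContinuousLinearMap.adjoint A := by
  rw [map_add, ContinuousLinearMap.adjoint_adjoint, add_comm]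

/-- `⟪p, (A + A†) q⟫ = ⟪(A + A†) p, q⟫`. -/
theorem inner_symmPart_comm (A : E3 →L[ℝ] E3) (p q : E3) :
    ⟪p, (A + ContinuousLinearMap.adjoint A) q⟫ = ⟪(A + ContinuousLinearMap.adjoint A) p, q⟫ := by
  rw [← ContinuousLinearMap.adjoint_inner_left, adjoint_symmPart]

/-- In an orthonormal eigenframe of `A + A†` the matrix of `A` is «half the rates on the diagonal plus an antisymmetric spin»:
`⟪uᵢ, A uⱼ⟫ + ⟪uⱼ, A uᵢ⟫ = eⱼ·[i = j]`. -/
theorem inner_frame_add_swap (hu : Orthonormal ℝ u) (hM : ∀ i, (A + ContinuousLinearMap.adjoint A) (u i) = e i • u i)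
    (i j : Fin 3) : ⟪u i, A (u j)⟫ + ⟪u j, A (u i)⟫ = if i = j then e j else 0 := by
  classical
  have h : ⟪u i, (A + ContinuousLinearMap.adjoint A) (u j)⟫ = ⟪u i, A (u j)⟫ + ⟪u j, A (u i)⟫ := by
    rw [add_apply, inner_add_right, ContinuousLinearMap.adjoint_inner_right, real_inner_comm (u j)]
  rw [← h, hM j, real_inner_smul_right, orthonormal_iff_ite.mp hu i j]
  split_ifs <;> simp

/-- Coordinates, in the eigenframe, of the second tower gradient operator `Q = A†(A + A†) + (A + A†)A` conjugated by the frame: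
`(R Q R⁻¹ y)ᵢ = Σⱼ yⱼ (eⱼ⟪uⱼ, A uᵢ⟫ + eᵢ⟪uᵢ, A uⱼ⟫)`. -/
theorem repr_towerQ_apply (hob : ∀ i, ob i = u i)
    (hM : ∀ i, (A + ContinuousLinearMap.adjoint A) (u i) = e i • u i) (y : E3) (i : Fin 3) :
    ob.repr ((ContinuousLinearMap.adjoint A) ((A + ContinuousLinearMap.adjoint A) (ob.repr.symm y))
        + (A + ContinuousLinearMap.adjoint A) (A (ob.repr.symm y))) i
      = y 0 * (e 0 * ⟪u 0, A (u i)⟫ + e i * ⟪u i, A (u 0)⟫) + y 1 * (e 1 * ⟪u 1, A (u i)⟫ + e i * ⟪u i, A (u 1)⟫)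
        + y 2 * (e 2 * ⟪u 2, A (u i)⟫ + e i * ⟪u i, A (u 2)⟫) := by
  have hz : ob.repr.symm y = ∑ j, y j • u j := by
    rw [← ob.sum_repr_symm y]
    simp only [hob]
  rw [repr_apply_eq_inner hob, inner_add_right, ContinuousLinearMap.adjoint_inner_right,
    inner_symmPart_comm A (u i) (A (ob.repr.symm y)), hM i, real_inner_smul_left, hz]
  simp only [Fin.sum_univ_three, map_add, map_smul, hM, smul_smul, inner_add_right, real_inner_smul_right,
    real_inner_comm (A (u i))]
  ring

/-- **The discriminant in the eigenframe.**  With `R = ob.repr` and `ε` the orientation sign of the frame,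
`D_A(R⁻¹y) = ε · ⟪y, diag(e) y × (R Q R⁻¹) y⟫`. -/
theorem linDisc_symm_apply (hu : Orthonormal ℝ u) (hob : ∀ i, ob i = u i)
    (hM : ∀ i, (A + ContinuousLinearMap.adjoint A) (u i) = e i • u i) {ε : ℝ} (hε1 : ε = 1 ∨ ε = -1)
    (hε : ∀ a b : E3, cross (ob.repr a) (ob.repr b) = ε • ob.repr (cross a b)) (y : E3) :
    ⟪ob.repr.symm y, cross ((A + ContinuousLinearMap.adjoint A) (ob.repr.symm y))
        ((ContinuousLinearMap.adjoint A) ((A + ContinuousLinearMap.adjoint A) (ob.repr.symm y))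
          + (A + ContinuousLinearMap.adjoint A) (A (ob.repr.symm y)))⟫
      = ε * ⟪y, cross (strain (e 0) (e 1) (e 2) y)
          (ob.repr ((ContinuousLinearMap.adjoint A) ((A + ContinuousLinearMap.adjoint A) (ob.repr.symm y))
            + (A + ContinuousLinearMap.adjoint A) (A (ob.repr.symm y))))⟫ := by
  have hεsq : ε * ε = 1 := by rcases hε1 with h | h <;> simp [h]
  have hR : ∀ p q : E3, ob.repr (cross p q) = ε • cross (ob.repr p) (ob.repr q) := fun p q => by
    rw [hε, smul_smul, hεsq, one_smul]
  rw [← LinearIsometryEquiv.inner_map_map ob.repr (ob.repr.symm y), LinearIsometryEquiv.apply_symm_apply, hR,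
    real_inner_smul_right, ← repr_strain hu hob hM (ob.repr.symm y), LinearIsometryEquiv.apply_symm_apply]

/-- The eigenframe cubic, fully in coordinates: for every `y`, `D_A(R⁻¹ y) = ε · P(y₀,y₁,y₂)` with `P` the explicit cubic below
in the rates `eᵢ` and the three spin entries `wᵢⱼ = ⟪uᵢ, A uⱼ⟫` (`i < j`; `Cᵢⱼ = (eᵢ − eⱼ)wᵢⱼ`, `Cᵢᵢ = eᵢ²`). -/
theorem linDisc_symm_coord (hu : Orthonormal ℝ u) (hob : ∀ i, ob i = u i)
    (hM : ∀ i, (A + ContinuousLinearMap.adjoint A) (u i) = e i • u i) {ε : ℝ} (hε1 : ε = 1 ∨ ε = -1)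
    (hε : ∀ a b : E3, cross (ob.repr a) (ob.repr b) = ε • ob.repr (cross a b)) (y : E3) :
    ⟪ob.repr.symm y, cross ((A + ContinuousLinearMap.adjoint A) (ob.repr.symm y))
        ((ContinuousLinearMap.adjoint A) ((A + ContinuousLinearMap.adjoint A) (ob.repr.symm y))
          + (A + ContinuousLinearMap.adjoint A) (A (ob.repr.symm y)))⟫
      = ε * (y 0 * (e 1 * y 1 * (y 0 * ((e 0 - e 2) * ⟪u 0, A (u 2)⟫) + y 1 * ((e 1 - e 2) * ⟪u 1, A (u 2)⟫) + y 2 * e 2 ^ 2) - e 2 * y 2 * (y 0 * ((e 0 - e 1) * ⟪u 0, A (u 1)⟫) + y 1 * e 1 ^ 2 + y 2 * ((e 1 - e 2) * ⟪u 1, A (u 2)⟫)))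
            + y 1 * (e 2 * y 2 * (y 0 * e 0 ^ 2 + y 1 * ((e 0 - e 1) * ⟪u 0, A (u 1)⟫) + y 2 * ((e 0 - e 2) * ⟪u 0, A (u 2)⟫)) - e 0 * y 0 * (y 0 * ((e 0 - e 2) * ⟪u 0, A (u 2)⟫) + y 1 * ((e 1 - e 2) * ⟪u 1, A (u 2)⟫) + y 2 * e 2 ^ 2))
            + y 2 * (e 0 * y 0 * (y 0 * ((e 0 - e 1) * ⟪u 0, A (u 1)⟫) + y 1 * e 1 ^ 2 + y 2 * ((e 1 - e 2) * ⟪u 1, A (u 2)⟫)) - e 1 * y 1 * (y 0 * e 0 ^ 2 + y 1 * ((e 0 - e 1) * ⟪u 0, A (u 1)⟫) + y 2 * ((e 0 - e 2) * ⟪u 0, A (u 2)⟫)))) := by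
  rw [linDisc_symm_apply hu hob hM hε1 hε y, inner_fin3]
  obtain ⟨k0, k1, k2⟩ := cross_fin3 (strain (e 0) (e 1) (e 2) y)
    (ob.repr ((ContinuousLinearMap.adjoint A) ((A + ContinuousLinearMap.adjoint A) (ob.repr.symm y))
      + (A + ContinuousLinearMap.adjoint A) (A (ob.repr.symm y))))
  rw [k0, k1, k2, repr_towerQ_apply hob hM y 0, repr_towerQ_apply hob hM y 1, repr_towerQ_apply hob hM y 2]
  -- the frame entries: `wⱼᵢ = −wᵢⱼ` (i ≠ j), `2wᵢᵢ = eᵢ`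
  have h := inner_frame_add_swap hu hM
  have h00 := h 0 0; have h11 := h 1 1; have h22 := h 2 2
  have g01 := h 0 1; have g02 := h 0 2; have g12 := h 1 2
  simp only [if_true] at h00 h11 h22
  simp only [show (0 : Fin 3) ≠ 1 by decide, show (0 : Fin 3) ≠ 2 by decide, show (1 : Fin 3) ≠ 2 by decide,
    if_false] at g01 g02 g12
  have s10 : ⟪u 1, A (u 0)⟫ = -⟪u 0, A (u 1)⟫ := by linarith
  have s20 : ⟪u 2, A (u 0)⟫ = -⟪u 0, A (u 2)⟫ := by linarith
  have s21 : ⟪u 2, A (u 1)⟫ = -⟪u 1, A (u 2)⟫ := by linarith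
  have s00 : ⟪u 0, A (u 0)⟫ = e 0 / 2 := by linarith
  have s11 : ⟪u 1, A (u 1)⟫ = e 1 / 2 := by linarith
  have s22 : ⟪u 2, A (u 2)⟫ = e 2 / 2 := by linarith
  simp only [strain, PiLp.toLp_apply, Matrix.cons_val_zero, Matrix.cons_val_one, Matrix.cons_val_two, Matrix.head_cons,
    Matrix.tail_cons, s10, s20, s21, s00, s11, s22]
  ring

end Frame

/-! ### Triaxial symmetric part: the discriminant never vanishes identically -/

section Triaxial

/-- ★ **The discriminant of a linear drift with TRIAXIAL symmetric part is not identically zero — for every spin.**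
If `A + A†` has an orthonormal eigenframe `u` with pairwise distinct eigenvalues `e`, then `D_A(v) ≠ 0` for some `v`:
the signed sum of `D_A` over the eight frame corners `R⁻¹(±1,±1,±1)` equals `±8(e₀−e₁)(e₁−e₂)(e₂−e₀)`. -/
theorem linDisc_exists_ne_zero_of_triaxial (A : E3 →L[ℝ] E3) (u : Fin 3 → E3) (e : Fin 3 → ℝ) (hu : Orthonormal ℝ u)
    (he : Function.Injective e) (hM : ∀ i, (A + ContinuousLinearMap.adjoint A) (u i) = e i • u i) :
    ∃ v : E3, ⟪v, cross ((A + ContinuousLinearMap.adjoint A) v)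
      ((ContinuousLinearMap.adjoint A) ((A + ContinuousLinearMap.adjoint A) v)
        + (A + ContinuousLinearMap.adjoint A) (A v))⟫ ≠ 0 := by
  by_contra hall
  push Not at hall
  obtain ⟨ob, hob⟩ := exists_orthonormalBasis_eq hu
  obtain ⟨ε, hε1, hε⟩ := exists_sign_cross_map ob.repr
  obtain ⟨h01, h12, h20⟩ := ne_of_injective he
  -- the cubic at the corner `R⁻¹(s₀,s₁,s₂)`
  have hc : ∀ s0 s1 s2 : ℝ,
      ε * (s0 * (e 1 * s1 * (s0 * ((e 0 - e 2) * ⟪u 0, A (u 2)⟫) + s1 * ((e 1 - e 2) * ⟪u 1, A (u 2)⟫) + s2 * e 2 ^ 2) - e 2 * s2 * (s0 * ((e 0 - e 1) * ⟪u 0, A (u 1)⟫) + s1 * e 1 ^ 2 + s2 * ((e 1 - e 2) * ⟪u 1, A (u 2)⟫)))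
            + s1 * (e 2 * s2 * (s0 * e 0 ^ 2 + s1 * ((e 0 - e 1) * ⟪u 0, A (u 1)⟫) + s2 * ((e 0 - e 2) * ⟪u 0, A (u 2)⟫)) - e 0 * s0 * (s0 * ((e 0 - e 2) * ⟪u 0, A (u 2)⟫) + s1 * ((e 1 - e 2) * ⟪u 1, A (u 2)⟫) + s2 * e 2 ^ 2))
            + s2 * (e 0 * s0 * (s0 * ((e 0 - e 1) * ⟪u 0, A (u 1)⟫) + s1 * e 1 ^ 2 + s2 * ((e 1 - e 2) * ⟪u 1, A (u 2)⟫)) - e 1 * s1 * (s0 * e 0 ^ 2 + s1 * ((e 0 - e 1) * ⟪u 0, A (u 1)⟫) + s2 * ((e 0 - e 2) * ⟪u 0, A (u 2)⟫)))) = 0 := by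
    intro s0 s1 s2
    have hy := hall (ob.repr.symm (WithLp.toLp 2 ![s0, s1, s2]))
    rw [linDisc_symm_coord hu hob hM hε1 hε] at hy
    simpa only [PiLp.toLp_apply, Matrix.cons_val_zero, Matrix.cons_val_one, Matrix.cons_val_two, Matrix.head_cons,
      Matrix.tail_cons] using hy
  -- signed sum over the eight corners isolates the `s₀s₁s₂`-coefficient: `8 ε (e₀−e₁)(e₁−e₂)(e₂−e₀)`
  have key : ε * (8 * ((e 0 - e 1) * (e 1 - e 2) * (e 2 - e 0))) = 0 := by
    linear_combination hc 1 1 1 - hc (-1) 1 1 - hc 1 (-1) 1 - hc 1 1 (-1) + hc (-1) (-1) 1 + hc (-1) 1 (-1)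
      + hc 1 (-1) (-1) - hc (-1) (-1) (-1)
  have hε0 : ε ≠ 0 := by rcases hε1 with h | h <;> simp [h]
  have hV : (e 0 - e 1) * (e 1 - e 2) * (e 2 - e 0) ≠ 0 :=
    mul_ne_zero (mul_ne_zero (sub_ne_zero.mpr h01) (sub_ne_zero.mpr h12)) (sub_ne_zero.mpr h20)
  exact absurd key (mul_ne_zero hε0 (mul_ne_zero (by norm_num) hV))

/-- ★★ **INVISCID STRAIN RIGIDITY SURVIVES BACKGROUND VORTICITY.**  Let `A : ℝ³ →L[ℝ] ℝ³` be any velocity gradient whose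
symmetrised part `A + A†` has an orthonormal eigenframe with PAIRWISE DISTINCT eigenvalues (a triaxial strain; the antisymmetric part
— the background vorticity — and the trace are arbitrary).  Then every smooth field `B` frozen into the linear drift `u = A(x − x₀)`
(`∂ₜB + DB[A(x − x₀)] − A B = 0`) on an open `I × U` and tangent to the spheres about `x₀` vanishes identically.
(`linDisc_exists_ne_zero_of_triaxial` + `linearFlowRigidity_of_ne_zero`; `InviscidStrainRigidity` is the spin-free diagonal case.) -/
theorem inviscidLinearFlowRigidity_triaxial (A : E3 →L[ℝ] E3) (u : Fin 3 → E3) (e : Fin 3 → ℝ) (x₀ : E3)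
    (B : ℝ → E3 → E3) (I : Set ℝ) (U : Set E3) (hu : Orthonormal ℝ u) (he : Function.Injective e)
    (hM : ∀ i, (A + ContinuousLinearMap.adjoint A) (u i) = e i • u i) (hI : IsOpen I) (hU : IsOpen U)
    (hB : ContDiffOn ℝ (⊤ : ℕ∞) (uncurry B) (I ×ˢ U))
    (hfrozen : ∀ t ∈ I, ∀ x ∈ U, deriv (fun s => B s x) t + fderiv ℝ (B t) x (A (x - x₀)) - A (B t x) = 0)
    (htan : ∀ t ∈ I, ∀ x ∈ U, ⟪B t x, x - x₀⟫ = 0) :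
    ∀ t ∈ I, ∀ x ∈ U, B t x = 0 := by
  obtain ⟨v, hv⟩ := linDisc_exists_ne_zero_of_triaxial A u e hu he hM
  exact linearFlowRigidity_of_ne_zero A x₀ B I U hI hU hB hfrozen htan hv

/-- The same with INTRINSIC hypotheses: `A + A†` has simple spectrum (every eigenspace of dimension `≤ 1`). -/
theorem inviscidLinearFlowRigidity_of_simpleSpectrum (A : E3 →L[ℝ] E3) (x₀ : E3) (B : ℝ → E3 → E3) (I : Set ℝ)
    (U : Set E3)
    (hsimple : ∀ μ : ℝ, Module.finrank ℝ
      (Module.End.eigenspace ((A + ContinuousLinearMap.adjoint A : E3 →L[ℝ] E3) : E3 →ₗ[ℝ] E3) μ) ≤ 1)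
    (hI : IsOpen I) (hU : IsOpen U) (hB : ContDiffOn ℝ (⊤ : ℕ∞) (uncurry B) (I ×ˢ U))
    (hfrozen : ∀ t ∈ I, ∀ x ∈ U, deriv (fun s => B s x) t + fderiv ℝ (B t) x (A (x - x₀)) - A (B t x) = 0)
    (htan : ∀ t ∈ I, ∀ x ∈ U, ⟪B t x, x - x₀⟫ = 0) :
    ∀ t ∈ I, ∀ x ∈ U, B t x = 0 := by
  have hsym : ((A + ContinuousLinearMap.adjoint A : E3 →L[ℝ] E3) : E3 →ₗ[ℝ] E3).IsSymmetric :=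
    (ContinuousLinearMap.isSelfAdjoint_iff_isSymmetric.mp (by
      rw [ContinuousLinearMap.isSelfAdjoint_iff']
      exact adjoint_symmPart A))
  obtain ⟨u, e, hu, he, hM, -⟩ := exists_eigenframe_of_isSymmetric _ hsym hsimple
  exact inviscidLinearFlowRigidity_triaxial A u e x₀ B I U hu he hM hI hU hB hfrozen htan

end Triaxial

end Summit.NavierStokesRegularity.NavierStokesRegularity.Theorems.PoloidalLiouville.ErtelTower

end
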